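import Summits.HodgeConjecture.CorCM.GenericCMFieldSameFieldFamiliesHodge
import Summits.HodgeConjecture.CorCM.GenericCMFieldPairFlipCriteria
import Literature.NumberTheory.ComplexMultiplication.SexticCMFieldPrimitive
import Literature.NumberTheory.ComplexMultiplication.CMTypeDictionaryGroupLevel
import Literature.NumberTheory.ComplexMultiplication.CMFieldNormalClosure
import HarnessLib

/-!
# Sextic CM fields whose Galois closure has degree `24` or `48` have pair flips: the four isogeny classes of CM
# abelian threefolds with CM by such a field — any three satisfy the Hodge conjecture on all products, all four
# carry an exceptional Hodge class

COR-CM (cell `pub-hodgecm2`), seat p2 gen 21; count-neutral; theorems only, no definition, no named fact, no `sorry`.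
The BRIDGE from the field class of stage 1 (`Literature/NumberTheory/ComplexMultiplication/SexticCMFieldPrimitive`:
`K` sextic CM with normal closure `L`, `[L:ℚ] ∈ {24, 48}`, i.e. `Gal(L/ℚ) ≅ (ℤ/2)³ ⋊ ℤ/3` or `(ℤ/2)³ ⋊ 𝔖₃` — Dodson's
sextic CM fields without imaginary quadratic subfield) to the PAIR-FLIP hypothesis of `CorCM/GenericCMFieldTypes`,
`…/GenericCMFieldSameFieldFamiliesHodge`, `…/GenericCMFieldPairFlipCriteria`:

* §1 `exists_flip_of_card_of_central_involution` — abstract: a group of order `24` or `48` acting faithfully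
  on six points with a central fixed-point-free involution `c` contains, for every point `x₀`, an element acting as
  `c` on `{x₀, c x₀}` and trivially elsewhere (the sign change `f0 ∈ 𝒢` of `SexticB3.flips_mem`, read back through the
  normal form `exists_equiv_cc`);
* §2 **`pairFlip_of_finrank_normalClosure`** — for a sextic CM field `K` with a normal closure `L` of degree `24` or
  `48`, every conjugate pair of complex embeddings of `K` is flipped by an automorphism of `ℂ` fixing the other four
  (`Gal(L/ℚ)` on `Hom_ℚ(K, L)` ↦ `Aut(ℂ)` on `Hom(K, ℂ)` by `CMTypeDictionaryGroupLevel`);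
* §3 hence, BY NAME for such `K`: every CM type is nondegenerate, every CM abelian variety with CM by `K` is simple
  (`isSimple_of_finrank_normalClosure`), a family of types is nondegenerate iff its type vectors are independent,
  **`hodgeConjectureFor_prod_of_card_le_three_of_finrank_normalClosure`** (≤ 3 pairwise non-isogenous CM abelian
  threefolds with CM by `K`: the Hodge conjecture on every product, unconditionally) and
  **`exists_exceptional_prod_of_three_lt_card_of_finrank_normalClosure`** (≥ 4 of them: an exceptional Hodge class
  on some product).
-/

noncomputable section

open CategoryTheory CategoryTheory.Limits NumberField

namespace Summit.HodgeConjecture.CorCM.GenericCMField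

/-! ## §1 The abstract flip -/

section Abstract

open Equiv Literature.NumberTheory.ComplexMultiplication Literature.NumberTheory.ComplexMultiplication.SexticB3

variable {G : Type*} [Group G] {X : Type*} [Fintype X] [DecidableEq X] [MulAction G X] [FaithfulSMul G X]

/-- **A group of order `24` or `48` acting faithfully on six points with a central fixed-point-free involution `c`
flips every pair**: for every `x₀` some `g ∈ G` acts as `c` on `{x₀, c • x₀}` and trivially on the other four points
(the sign change `f0` of `flips_mem` in the normal form `e : X ≃ Fin 6`, `e x₀ = 0`, `e ∘ c = cc ∘ e`).
[cite: Dodson1984, §5.1.2 Theorem] -/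
theorem exists_flip_of_card_of_central_involution (hX : Fintype.card X = 6)
    (hcard : Nat.card G = 24 ∨ Nat.card G = 48) (c : G) (hcen : ∀ g : G, c * g = g * c) (hc2 : c * c = 1)
    (hfix : ∀ x : X, c • x ≠ x) (x₀ : X) :
    ∃ g : G, g • x₀ = c • x₀ ∧ ∀ y : X, y ≠ x₀ → y ≠ c • x₀ → g • y = y := by
  obtain ⟨e, he0, hce⟩ := exists_equiv_cc hX (MulAction.toPerm c)
    (fun x => by simp [MulAction.toPerm_apply, smul_smul, hc2]) (fun x => hfix x) x₀
  replace hce : ∀ x, e (c • x) = cc (e x) := fun x => by simpa [MulAction.toPerm_apply] using hce x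
  set f : G →* Perm (Fin 6) := toPerm6 e with hf
  have hfinj : Function.Injective f := toPerm6_injective e
  have hW : f.range ≤ W := range_toPerm6_le_W hcen hce
  have hcc : cc ∈ f.range := ⟨c, toPerm6_eq_cc hce⟩
  have hcard' : Nat.card f.range = 24 ∨ Nat.card f.range = 48 := by
    rwa [← Nat.card_congr (MonoidHom.ofInjective hfinj).toEquiv]
  obtain ⟨⟨g, hg⟩, -, -⟩ := flips_mem f.range hW hcc hcard'
  have hgy : ∀ y : X, e (g • y) = swap (0 : Fin 6) 3 (e y) := fun y => by
    have := congrArg (fun p : Perm (Fin 6) => p (e y)) hg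
    simpa only [hf, toPerm6_apply, Equiv.symm_apply_apply, f0] using this
  have hc0 : e (c • x₀) = 3 := by rw [hce, he0, cc_apply]; decide
  refine ⟨g, e.injective ?_, fun y hy hyc => e.injective ?_⟩
  · rw [hgy, he0, hc0, swap_apply_left]
  · rw [hgy]
    exact swap_apply_of_ne_of_ne (fun h => hy (e.injective (h.trans he0.symm)))
      (fun h => hyc (e.injective (h.trans hc0.symm)))

end Abstract

/-! ## §2 Sextic CM fields with Galois closure of degree `24` or `48` have pair flips -/

open Literature.NumberTheory.ComplexMultiplication
open Literature.AlgebraicGeometry.Motives (AbelianVariety CMType)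
open Literature.AlgebraicGeometry.HodgeTheory
open Literature.AlgebraicGeometry.ComplexMultiplication (IsCMTypeRealisation)
open Literature.AlgebraicGeometry.VanGeemen1994 (hodgeClassSpan)
open Literature.AlgebraicGeometry.Pohlmann1968
open Literature.Barriers.HodgeConjecture (divisorClassesSpan)

variable {K : Type} [Field K] [NumberField K] [IsCMField K]

/-- **A sextic CM field whose normal closure `L` has degree `24` or `48` has pair flips**: every conjugate pair
`{s, s̄}` of complex embeddings of `K` is exchanged by an automorphism of `ℂ` fixing the four other embeddings. -/
theorem pairFlip_of_finrank_normalClosure (h6 : Module.finrank ℚ K = 6) (L : Type) [Field L] [NumberField L]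
    [IsNormalClosure ℚ K L] (hL : Module.finrank ℚ L = 24 ∨ Module.finrank ℚ L = 48) :
    ∀ s : K →+* ℂ, ∃ σ : ℂ ≃+* ℂ, σ • s = (starRingAut : ℂ ≃+* ℂ) • s ∧
      ∀ t : K →+* ℂ, t ≠ s → t ≠ (starRingAut : ℂ ≃+* ℂ) • s → σ • t = t := by
  classical
  haveI : IsCMField L := isCMField_of_isNormalClosure (K := K) (L := L)
  haveI : IsGalois ℚ L := isGalois_of_isNormalClosure (L := L) K
  have hX : Fintype.card (K →ₐ[ℚ] L) = 6 := by rw [card_algHom_eq_finrank K, h6]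
  have hcard : Nat.card (L ≃ₐ[ℚ] L) = 24 ∨ Nat.card (L ≃ₐ[ℚ] L) = 48 := by
    rwa [IsGalois.card_aut_eq_finrank]
  obtain ⟨j⟩ : Nonempty (K →ₐ[ℚ] L) := Fintype.card_pos_iff.1 (by rw [hX]; norm_num)
  obtain ⟨ι⟩ : Nonempty (L →+* ℂ) := inferInstance
  set e := algHomEquivRingHomOfNormal j ι with he
  intro s
  obtain ⟨g, hg0, hgy⟩ := exists_flip_of_card_of_central_involution hX hcard
    (conjGal : L ≃ₐ[ℚ] L) conjGal_central conjGal_mul_conjGal conjGal_smul_ne (e.symm s)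
  obtain ⟨τ, hτ⟩ := exists_ringEquiv_forall_algHomEquivRingHomOfNormal_smul j ι g
  have hcs : e ((conjGal : L ≃ₐ[ℚ] L) • e.symm s) = (starRingAut : ℂ ≃+* ℂ) • s := by
    rw [he, algHomEquivRingHomOfNormal_conjGal_smul, Equiv.apply_symm_apply, conj_smul_eq_conjugate]
  refine ⟨τ, ?_, fun t hts htc => ?_⟩
  · have h := hτ (e.symm s)
    rw [Equiv.apply_symm_apply, hg0] at h
    rw [← h, ← he, hcs]
  · have h := hτ (e.symm t)
    rw [Equiv.apply_symm_apply] at h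
    rw [← h, hgy (e.symm t) (fun h' => hts ?_) (fun h' => htc ?_), Equiv.apply_symm_apply]
    · rw [← e.apply_symm_apply t, h', Equiv.apply_symm_apply]
    · rw [← e.apply_symm_apply t, h']
      exact hcs

/-! ## §3 The sextic theorems, by name, for `[L:ℚ] ∈ {24, 48}` -/

/-- **Every CM type of a sextic CM field with Galois closure of degree `24` or `48` is nondegenerate.** -/
theorem isNondegenerate_of_finrank_normalClosure (h6 : Module.finrank ℚ K = 6) (L : Type) [Field L]
    [NumberField L] [IsNormalClosure ℚ K L] (hL : Module.finrank ℚ L = 24 ∨ Module.finrank ℚ L = 48)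
    (Φ : CMType K) : IsNondegenerate Φ :=
  isNondegenerate_of_pairFlip (pairFlip_of_finrank_normalClosure h6 L hL) Φ

/-- **Every CM abelian variety with CM by a sextic CM field with Galois closure of degree `24` or `48` is simple.** -/
theorem isSimple_of_finrank_normalClosure (h6 : Module.finrank ℚ K = 6) (L : Type) [Field L] [NumberField L]
    [IsNormalClosure ℚ K L] (hL : Module.finrank ℚ L = 24 ∨ Module.finrank ℚ L = 48)
    {Φ : CMType K} {A : AbelianVariety ℂ} {ι : 𝓞 K →+* End A} {θ : K →+* Module.End ℂ (complexBetti A.X 1)}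
    (hA : IsCMTypeRealisation Φ A ι θ) : A.IsSimple :=
  isSimple_of_pairFlip (pairFlip_of_finrank_normalClosure h6 L hL) hA

variable {I : Type} [Fintype I] [Nonempty I] {Φ : I → CMType K} {A : I → AbelianVariety ℂ}
  {ι : ∀ i, 𝓞 K →+* End (A i)} {θ : ∀ i, K →+* Module.End ℂ (complexBetti (A i).X 1)}

/-- **For such `K`, a family of CM types is nondegenerate ⟺ its type vectors are linearly independent.** -/
theorem isNondegenerateFamily_iff_linearIndependent_of_finrank_normalClosure (h6 : Module.finrank ℚ K = 6)
    (L : Type) [Field L] [NumberField L] [IsNormalClosure ℚ K L]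
    (hL : Module.finrank ℚ L = 24 ∨ Module.finrank ℚ L = 48) [DecidableEq I] (Φ : I → CMType K) :
    CMAlgebra.IsNondegenerateFamily (K := fun _ : I => K) Φ ↔
      LinearIndependent ℚ fun i => antiVec (Φ i).1 (1 : ℂ ≃+* ℂ) :=
  isNondegenerateFamily_iff_linearIndependent_of_pairFlip (pairFlip_of_finrank_normalClosure h6 L hL) Φ

/-- **The Hodge conjecture on every product `X₁^a × X₂^b × X₃^c` of at most three pairwise non-isogenous CM abelian
threefolds with CM by ONE sextic CM field whose Galois closure has degree `24` or `48`** (the field class of the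
period programme's stage 1), UNCONDITIONALLY; all Hodge classes there are polynomials in divisor classes. -/
theorem hodgeConjectureFor_prod_of_card_le_three_of_finrank_normalClosure (h6 : Module.finrank ℚ K = 6)
    (L : Type) [Field L] [NumberField L] [IsNormalClosure ℚ K L]
    (hL : Module.finrank ℚ L = 24 ∨ Module.finrank ℚ L = 48)
    (hA : ∀ i, IsCMTypeRealisation (Φ i) (A i) (ι i) (θ i))
    (hniso : ∀ i j, i ≠ j → ¬AbelianVariety.IsIsogenous (A i) (A j)) (hcard : Fintype.card I ≤ 3)
    {N : ℕ} (π : Fin N → I) :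
    HodgeConjectureFor (⨁ fun j : Fin N => A (π j)).dim (⨁ fun j : Fin N => A (π j)).X :=
  hodgeConjectureFor_prod_of_card_le_three (pairFlip_of_finrank_normalClosure h6 L hL) hA hniso hcard π

/-- **Four or more pairwise non-isogenous CM abelian threefolds with CM by one such sextic field carry an
exceptional Hodge class on some product** (a rational `(m,m)`-class outside the span of intersections of divisors —
its algebraicity is an open instance of the Hodge conjecture). -/
theorem exists_exceptional_prod_of_three_lt_card_of_finrank_normalClosure (h6 : Module.finrank ℚ K = 6)
    (L : Type) [Field L] [NumberField L] [IsNormalClosure ℚ K L]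
    (hL : Module.finrank ℚ L = 24 ∨ Module.finrank ℚ L = 48)
    (hA : ∀ i, IsCMTypeRealisation (Φ i) (A i) (ι i) (θ i))
    (hniso : ∀ i j, i ≠ j → ¬AbelianVariety.IsIsogenous (A i) (A j)) (hcard : 3 < Fintype.card I) :
    ∃ (N : ℕ) (π : Fin N → I) (m : ℕ) (c : complexBetti (⨁ fun j : Fin N => A (π j)).X (2 * m)),
      IsRationalClass c ∧
      IsOfHodgeType (⨁ fun j : Fin N => A (π j)).dim (⨁ fun j : Fin N => A (π j)).X (2 * m) m m c ∧
      c ∉ divisorClassesSpan (⨁ fun j : Fin N => A (π j)).X (⨁ fun j : Fin N => A (π j)).dim m :=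
  exists_exceptional_prod_of_lt_card (pairFlip_of_finrank_normalClosure h6 L hL) hA hniso (by rw [h6]; omega)

end Summit.HodgeConjecture.CorCM.GenericCMField
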